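import Mathlib
import HarnessLib
import Summits.Ventures.LatticeQCDFlow.Exactness.NCMCGeneralSpaceBennettRoot
import Summits.Ventures.LatticeQCDFlow.Exactness.NCMCGeneralSpaceBennettOptimal
import Summits.Ventures.LatticeQCDFlow.Exactness.NCMCGeneralSpacePinskerFloor

/-!
# The noise and the sensitivity of Bennett's equation at its root: their ratio is Bennett's bound `1/G − 2`

HONEST FRAMING: exact (Metropolis-corrected) sampling algorithms for lattice gauge theory;
figures of merit are autocorrelation/cost numbers at stated couplings and volumes; no
continuum-physics claim.

Venture `LatticeQCDFlow` (cell pub-lqcd), topic `Exactness`; FANOUT row 13 (`eng-snf`, GEN-15).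
NEW WORK of the cell (three change-of-measure identities along a Crooks pair and bookkeeping), not a
published result; nothing is cited as a fact (C. H. Bennett, J. Comput. Phys. 22 (1976) 245, eqs.
(10)–(12); M. R. Shirts, E. Bair, G. Hooker, V. S. Pande, Phys. Rev. Lett. 91 (2003) 140601, named
only).  Companion of `NCMCGeneralSpaceBennettRootConsistency.lean` (the self-consistent BAR estimate
converges to `ΔF`) and input of the root's central limit theorem: the two population constants that
govern the fluctuations of the root of a monotone estimating equation — the NOISE `s²` (variance of
one summand at the root) and the SENSITIVITY `κ` (mean slope of one summand at the root) — computed in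
closed form for every Crooks pair.

## Setting

A Crooks pair `(κF, κR, s, e, W)` from `ν₀` to `ν₁`, `P_F = fwdPathLaw ν₀ κF`, `P_R = fwdPathLaw ν₁ κR`,
`dP_R/dP_F = e^{ΔF−W}` (`e^{−ΔF} = Z₁/Z₀`), `σ = Real.sigmoid`, `σ' = σ(1 − σ)`.  One pair of
evolutions contributes `ψ(d) = σ(d − W_F) − σ(W_R − d)` to the sample Bennett equation; at the root
`d = ΔF` write `σ₊ = σ(ΔF − W)` (read on forward records) and `σ₋ = σ(W − ΔF)` (read on reverse
records), and `G = E_{P_F} σ₊` — Bennett's OVERLAP, equal to `E_{P_R} σ₋` and to the `G` of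
`NCMCGeneralSpaceBennettOptimal.bennett_lower_bound` at `nf = nr = 1`.

## Content

* `CrooksPair.integral_sigmoid_rev_eq_overlap` — `E_R σ₋ = G`;
  `CrooksPair.integral_dsigmoid_rev_eq` — `E_R[σ₋(1 − σ₋)] = E_F[σ₊²]`;
  `CrooksPair.integral_sigmoid_sq_rev_eq` — `E_R[σ₋²] = E_F[σ₊(1 − σ₊)]`
  (change of measure `E_R φ = E_F[e^{ΔF−W} φ]` and `e^{ΔF−W} σ₋ = σ₊`, `1 − σ₋ = σ₊`).
* **`CrooksPair.barSensitivity_eq_overlap`** — THE SENSITIVITY IS THE OVERLAP: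
  `κ := E_F[σ'(ΔF − W)] + E_R[σ'(W − ΔF)] = G`.
* **`CrooksPair.barNoise_eq`** — THE NOISE: `s² := Var_F[σ₊] + Var_R[σ₋] = G(1 − 2G)`
  (so `G ≤ ½`, `CrooksPair.overlap_le_half`; `0 < G`, `CrooksPair.overlap_pos`).
* **`CrooksPair.barNoise_div_sensitivity_sq_eq`** — `s²/κ² = 1/G − 2`, and
  `CrooksPair.inv_overlap_sub_two_eq_bennett_bound` — this is LITERALLY the left side
  `1/G − 1/nf − 1/nr` of `bennett_lower_bound` at `nf = nr = 1`: the sandwich (M-estimator) variance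
  of the self-consistent root equals the least variance any FIXED positive statistic can reach
  (`bennett_lower_bound`, attained only by the Fermi weight centred at the unknown `ΔF`,
  `bennett_bound_attained` / `…BennettOptimalUnique`).  Not knowing `ΔF` costs nothing to leading
  order.

Scope / NOT CLAIMED: population identities only; the central limit theorem of the root that turns
`s²/κ²` into the variance of a limiting Gaussian is a separate file; paired sampling (`nf = nr`).
-/

namespace Summit.Ventures.LatticeQCDFlow.Exactness.GeneralNCMC

open MeasureTheory ProbabilityTheory Set Filter
open scoped ENNReal

variable {Ω E : Type*} [MeasurableSpace Ω] [MeasurableSpace E]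

/-! ## Pointwise identities of the Fermi function -/

omit [MeasurableSpace E] in
/-- `e^{ΔF − W} σ(W − ΔF) = σ(ΔF − W)`. -/
theorem exp_sub_mul_sigmoid_sub (a b : ℝ) :
    Real.exp (a - b) * Real.sigmoid (b - a) = Real.sigmoid (a - b) := by
  rw [mul_comm, show a - b = -(b - a) by ring]
  exact Real.sigmoid_mul_rexp_neg (b - a)

omit [MeasurableSpace E] in
/-- `1 − σ(W − ΔF) = σ(ΔF − W)`. -/
theorem one_sub_sigmoid_sub (a b : ℝ) : 1 - Real.sigmoid (b - a) = Real.sigmoid (a - b) := by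
  rw [show a - b = -(b - a) by ring, Real.sigmoid_neg]

/-- A bounded measurable function times a Fermi factor is integrable (probability law). -/
theorem integrable_sigmoid_mul_sigmoid {μ : Measure E} [IsProbabilityMeasure μ] {f g : E → ℝ}
    (hf : Measurable f) (hg : Measurable g) :
    Integrable (fun ε => Real.sigmoid (f ε) * Real.sigmoid (g ε)) μ := by
  refine (integrable_const (1 : ℝ)).mono'
    ((_root_.continuous_sigmoid.measurable.comp hf).mul
      (_root_.continuous_sigmoid.measurable.comp hg)).aestronglyMeasurable
    (Eventually.of_forall fun ε => ?_)
  rw [Real.norm_eq_abs, abs_of_nonneg (mul_nonneg (Real.sigmoid_nonneg _) (Real.sigmoid_nonneg _))]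
  exact mul_le_one₀ (Real.sigmoid_le_one _) (Real.sigmoid_nonneg _) (Real.sigmoid_le_one _)

/-- A Fermi factor is in `L²` of a probability law. -/
theorem memLp_two_sigmoid_comp {μ : Measure E} [IsProbabilityMeasure μ] {f : E → ℝ}
    (hf : Measurable f) : MemLp (fun ε => Real.sigmoid (f ε)) 2 μ :=
  MemLp.of_bound (_root_.continuous_sigmoid.measurable.comp hf).aestronglyMeasurable 1
    (Eventually.of_forall fun ε => by
      rw [Real.norm_eq_abs, abs_of_nonneg (Real.sigmoid_nonneg _)]
      exact Real.sigmoid_le_one _)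

namespace CrooksPair

variable {ν₀ ν₁ : Measure Ω} {κF κR : Kernel Ω E} {s e : E → Ω} {W : E → ℝ}

/-! ## Three change-of-measure identities at the root -/

/-- **`E_{P_R}[σ(W − ΔF)] = E_{P_F}[σ(ΔF − W)] = G`**: at the root both Fermi rates are the overlap. -/
theorem integral_sigmoid_rev_eq_overlap [IsFiniteMeasure ν₀] [IsFiniteMeasure ν₁] [IsMarkovKernel κF]
    [IsMarkovKernel κR] (h0 : ν₀ univ ≠ 0) (h1 : ν₁ univ ≠ 0) (h : CrooksPair ν₀ ν₁ κF κR s e W)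
    {ΔF : ℝ} (hΔF : Real.exp (-ΔF) = ((ν₀ univ)⁻¹ * ν₁ univ).toReal) :
    ∫ ε, Real.sigmoid (W ε - ΔF) ∂(fwdPathLaw ν₁ κR) = ∫ ε, Real.sigmoid (ΔF - W ε) ∂(fwdPathLaw ν₀ κF) :=
  ((h.integral_sigmoid_fwd_eq_rev_iff h0 h1 hΔF ΔF).2 rfl).symm

/-- **`E_{P_R}[σ₋(1 − σ₋)] = E_{P_F}[σ₊²]`** (`e^{ΔF−W} σ₋ = σ₊`, `1 − σ₋ = σ₊`). -/
theorem integral_dsigmoid_rev_eq [IsFiniteMeasure ν₀] [IsFiniteMeasure ν₁] [IsMarkovKernel κF]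
    [IsMarkovKernel κR] (h0 : ν₀ univ ≠ 0) (h1 : ν₁ univ ≠ 0) (h : CrooksPair ν₀ ν₁ κF κR s e W)
    {ΔF : ℝ} (hΔF : Real.exp (-ΔF) = ((ν₀ univ)⁻¹ * ν₁ univ).toReal) :
    ∫ ε, Real.sigmoid (W ε - ΔF) * (1 - Real.sigmoid (W ε - ΔF)) ∂(fwdPathLaw ν₁ κR) =
      ∫ ε, Real.sigmoid (ΔF - W ε) ^ 2 ∂(fwdPathLaw ν₀ κF) := by
  rw [← h.integral_density_mul h0 h1 hΔF]
  refine integral_congr_ae (Eventually.of_forall fun ε => ?_)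
  simp only
  rw [← mul_assoc, exp_sub_mul_sigmoid_sub, one_sub_sigmoid_sub, sq]

/-- **`E_{P_R}[σ₋²] = E_{P_F}[σ₊(1 − σ₊)]`**. -/
theorem integral_sigmoid_sq_rev_eq [IsFiniteMeasure ν₀] [IsFiniteMeasure ν₁] [IsMarkovKernel κF]
    [IsMarkovKernel κR] (h0 : ν₀ univ ≠ 0) (h1 : ν₁ univ ≠ 0) (h : CrooksPair ν₀ ν₁ κF κR s e W)
    {ΔF : ℝ} (hΔF : Real.exp (-ΔF) = ((ν₀ univ)⁻¹ * ν₁ univ).toReal) :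
    ∫ ε, Real.sigmoid (W ε - ΔF) ^ 2 ∂(fwdPathLaw ν₁ κR) =
      ∫ ε, Real.sigmoid (ΔF - W ε) * (1 - Real.sigmoid (ΔF - W ε)) ∂(fwdPathLaw ν₀ κF) := by
  rw [← h.integral_density_mul h0 h1 hΔF]
  refine integral_congr_ae (Eventually.of_forall fun ε => ?_)
  simp only
  rw [sq, ← mul_assoc, exp_sub_mul_sigmoid_sub, ← one_sub_sigmoid_sub ΔF (W ε), sub_sub_cancel]

/-! ## Sensitivity, noise, and their ratio -/

/-- **The sensitivity of Bennett's equation at its root is the overlap**: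
`E_{P_F}[σ'(ΔF − W)] + E_{P_R}[σ'(W − ΔF)] = E_{P_F}[σ(ΔF − W)]` (`σ' = σ(1 − σ)`). -/
theorem barSensitivity_eq_overlap [IsFiniteMeasure ν₀] [IsFiniteMeasure ν₁] [IsMarkovKernel κF]
    [IsMarkovKernel κR] (h0 : ν₀ univ ≠ 0) (h1 : ν₁ univ ≠ 0) (h : CrooksPair ν₀ ν₁ κF κR s e W)
    {ΔF : ℝ} (hΔF : Real.exp (-ΔF) = ((ν₀ univ)⁻¹ * ν₁ univ).toReal) :
    (∫ ε, Real.sigmoid (ΔF - W ε) * (1 - Real.sigmoid (ΔF - W ε)) ∂(fwdPathLaw ν₀ κF)) +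
        ∫ ε, Real.sigmoid (W ε - ΔF) * (1 - Real.sigmoid (W ε - ΔF)) ∂(fwdPathLaw ν₁ κR) =
      ∫ ε, Real.sigmoid (ΔF - W ε) ∂(fwdPathLaw ν₀ κF) := by
  haveI := isProbabilityMeasure_fwdPathLaw ν₀ h0 κF
  have hm : Measurable fun ε => ΔF - W ε := measurable_const.sub h.measurable_W
  have hi1 : Integrable (fun ε => Real.sigmoid (ΔF - W ε) * (1 - Real.sigmoid (ΔF - W ε)))
      (fwdPathLaw ν₀ κF) := by
    have := integrable_sigmoid_mul_sigmoid (μ := fwdPathLaw ν₀ κF) (f := fun ε => ΔF - W ε)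
      (g := fun ε => W ε - ΔF) hm (h.measurable_W.sub measurable_const)
    refine this.congr (Eventually.of_forall fun ε => ?_)
    simp only
    rw [one_sub_sigmoid_sub (W ε) ΔF]
  have hi2 : Integrable (fun ε => Real.sigmoid (ΔF - W ε) ^ 2) (fwdPathLaw ν₀ κF) := by
    have := integrable_sigmoid_mul_sigmoid (μ := fwdPathLaw ν₀ κF) (f := fun ε => ΔF - W ε)
      (g := fun ε => ΔF - W ε) hm hm
    refine this.congr (Eventually.of_forall fun ε => ?_)
    simp only
    rw [sq]
  rw [h.integral_dsigmoid_rev_eq h0 h1 hΔF, ← integral_add hi1 hi2]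
  refine integral_congr_ae (Eventually.of_forall fun ε => ?_)
  simp only
  ring

/-- **The overlap is positive**: `0 < G`. -/
theorem overlap_pos [IsFiniteMeasure ν₀] [IsMarkovKernel κF] (h0 : ν₀ univ ≠ 0)
    (h : CrooksPair ν₀ ν₁ κF κR s e W) (ΔF : ℝ) :
    0 < ∫ ε, Real.sigmoid (ΔF - W ε) ∂(fwdPathLaw ν₀ κF) := by
  haveI := isProbabilityMeasure_fwdPathLaw ν₀ h0 κF
  have hi : Integrable (fun ε => Real.sigmoid (ΔF - W ε)) (fwdPathLaw ν₀ κF) :=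
    integrable_sigmoid_comp (measurable_const.sub h.measurable_W)
  rw [integral_pos_iff_support_of_nonneg (fun ε => Real.sigmoid_nonneg _) hi]
  have hsupp : Function.support (fun ε => Real.sigmoid (ΔF - W ε)) = univ := by
    ext ε
    simp only [Function.mem_support, mem_univ, iff_true]
    exact (Real.sigmoid_pos _).ne'
  rw [hsupp, measure_univ]
  exact one_pos

/-- `Var_{P_F}[σ(ΔF − W)] = E_{P_F}[σ₊²] − G²`. -/
theorem variance_sigmoid_fwd_eq [IsFiniteMeasure ν₀] [IsMarkovKernel κF] (h0 : ν₀ univ ≠ 0)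
    (h : CrooksPair ν₀ ν₁ κF κR s e W) (ΔF : ℝ) :
    Var[fun ε => Real.sigmoid (ΔF - W ε); fwdPathLaw ν₀ κF] =
      (∫ ε, Real.sigmoid (ΔF - W ε) ^ 2 ∂(fwdPathLaw ν₀ κF)) -
        (∫ ε, Real.sigmoid (ΔF - W ε) ∂(fwdPathLaw ν₀ κF)) ^ 2 := by
  haveI := isProbabilityMeasure_fwdPathLaw ν₀ h0 κF
  rw [variance_eq_sub (memLp_two_sigmoid_comp (μ := fwdPathLaw ν₀ κF) (f := fun ε => ΔF - W ε)
    (measurable_const.sub h.measurable_W))]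
  rfl

/-- `Var_{P_R}[σ(W − ΔF)] = E_{P_F}[σ₊(1 − σ₊)] − G²` (both moments moved to the forward lane). -/
theorem variance_sigmoid_rev_eq [IsFiniteMeasure ν₀] [IsFiniteMeasure ν₁] [IsMarkovKernel κF]
    [IsMarkovKernel κR] (h0 : ν₀ univ ≠ 0) (h1 : ν₁ univ ≠ 0) (h : CrooksPair ν₀ ν₁ κF κR s e W)
    {ΔF : ℝ} (hΔF : Real.exp (-ΔF) = ((ν₀ univ)⁻¹ * ν₁ univ).toReal) :
    Var[fun ε => Real.sigmoid (W ε - ΔF); fwdPathLaw ν₁ κR] =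
      (∫ ε, Real.sigmoid (ΔF - W ε) * (1 - Real.sigmoid (ΔF - W ε)) ∂(fwdPathLaw ν₀ κF)) -
        (∫ ε, Real.sigmoid (ΔF - W ε) ∂(fwdPathLaw ν₀ κF)) ^ 2 := by
  haveI := isProbabilityMeasure_fwdPathLaw ν₁ h1 κR
  rw [variance_eq_sub (memLp_two_sigmoid_comp (μ := fwdPathLaw ν₁ κR) (f := fun ε => W ε - ΔF)
    (h.measurable_W.sub measurable_const)),
    ← h.integral_sigmoid_sq_rev_eq h0 h1 hΔF, ← h.integral_sigmoid_rev_eq_overlap h0 h1 hΔF]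
  rfl

/-- **The noise of Bennett's equation at its root**: `Var_{P_F}[σ(ΔF − W)] + Var_{P_R}[σ(W − ΔF)] =
G(1 − 2G)` — the variance of one pair's contribution `σ(ΔF − W_F) − σ(W_R − ΔF)` (independent
legs), in terms of the overlap alone. -/
theorem barNoise_eq [IsFiniteMeasure ν₀] [IsFiniteMeasure ν₁] [IsMarkovKernel κF]
    [IsMarkovKernel κR] (h0 : ν₀ univ ≠ 0) (h1 : ν₁ univ ≠ 0) (h : CrooksPair ν₀ ν₁ κF κR s e W)
    {ΔF : ℝ} (hΔF : Real.exp (-ΔF) = ((ν₀ univ)⁻¹ * ν₁ univ).toReal) :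
    Var[fun ε => Real.sigmoid (ΔF - W ε); fwdPathLaw ν₀ κF] +
        Var[fun ε => Real.sigmoid (W ε - ΔF); fwdPathLaw ν₁ κR] =
      (∫ ε, Real.sigmoid (ΔF - W ε) ∂(fwdPathLaw ν₀ κF)) *
        (1 - 2 * ∫ ε, Real.sigmoid (ΔF - W ε) ∂(fwdPathLaw ν₀ κF)) := by
  have hBA : (∫ ε, Real.sigmoid (ΔF - W ε) * (1 - Real.sigmoid (ΔF - W ε)) ∂(fwdPathLaw ν₀ κF)) +
      ∫ ε, Real.sigmoid (ΔF - W ε) ^ 2 ∂(fwdPathLaw ν₀ κF) =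
      ∫ ε, Real.sigmoid (ΔF - W ε) ∂(fwdPathLaw ν₀ κF) := by
    rw [← h.integral_dsigmoid_rev_eq h0 h1 hΔF]
    exact h.barSensitivity_eq_overlap h0 h1 hΔF
  rw [h.variance_sigmoid_fwd_eq h0 ΔF, h.variance_sigmoid_rev_eq h0 h1 hΔF]
  linear_combination hBA

/-- **The overlap is at most one half**: `G ≤ ½` (the noise `G(1 − 2G)` is a sum of variances). -/
theorem overlap_le_half [IsFiniteMeasure ν₀] [IsFiniteMeasure ν₁] [IsMarkovKernel κF]
    [IsMarkovKernel κR] (h0 : ν₀ univ ≠ 0) (h1 : ν₁ univ ≠ 0) (h : CrooksPair ν₀ ν₁ κF κR s e W)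
    {ΔF : ℝ} (hΔF : Real.exp (-ΔF) = ((ν₀ univ)⁻¹ * ν₁ univ).toReal) :
    ∫ ε, Real.sigmoid (ΔF - W ε) ∂(fwdPathLaw ν₀ κF) ≤ 1 / 2 := by
  have hG := h.overlap_pos h0 ΔF
  have hnn : 0 ≤ Var[fun ε => Real.sigmoid (ΔF - W ε); fwdPathLaw ν₀ κF] +
      Var[fun ε => Real.sigmoid (W ε - ΔF); fwdPathLaw ν₁ κR] :=
    add_nonneg (variance_nonneg _ _) (variance_nonneg _ _)
  rw [h.barNoise_eq h0 h1 hΔF] at hnn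
  have h2 : 0 ≤ 1 - 2 * ∫ ε, Real.sigmoid (ΔF - W ε) ∂(fwdPathLaw ν₀ κF) :=
    nonneg_of_mul_nonneg_right hnn hG
  linarith

/-- **Noise over squared sensitivity is Bennett's bound**: `s²/κ² = 1/G − 2`. -/
theorem barNoise_div_sensitivity_sq_eq [IsFiniteMeasure ν₀] [IsFiniteMeasure ν₁] [IsMarkovKernel κF]
    [IsMarkovKernel κR] (h0 : ν₀ univ ≠ 0) (h1 : ν₁ univ ≠ 0) (h : CrooksPair ν₀ ν₁ κF κR s e W)
    {ΔF : ℝ} (hΔF : Real.exp (-ΔF) = ((ν₀ univ)⁻¹ * ν₁ univ).toReal) :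
    (Var[fun ε => Real.sigmoid (ΔF - W ε); fwdPathLaw ν₀ κF] +
        Var[fun ε => Real.sigmoid (W ε - ΔF); fwdPathLaw ν₁ κR]) /
      ((∫ ε, Real.sigmoid (ΔF - W ε) * (1 - Real.sigmoid (ΔF - W ε)) ∂(fwdPathLaw ν₀ κF)) +
        ∫ ε, Real.sigmoid (W ε - ΔF) * (1 - Real.sigmoid (W ε - ΔF)) ∂(fwdPathLaw ν₁ κR)) ^ 2 =
      1 / (∫ ε, Real.sigmoid (ΔF - W ε) ∂(fwdPathLaw ν₀ κF)) - 2 := by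
  have hG := h.overlap_pos h0 ΔF
  rw [h.barNoise_eq h0 h1 hΔF, h.barSensitivity_eq_overlap h0 h1 hΔF]
  field_simp

omit [MeasurableSpace E] in
/-- Bennett's `g`-weight at `nf = nr = 1` is the Fermi function: `(e^{ΔF−W}/1 + 1/1)⁻¹ = σ(W − ΔF)`. -/
theorem inv_exp_sub_add_one_eq_sigmoid (W : E → ℝ) (ΔF : ℝ) (ε : E) :
    (Real.exp (ΔF - W ε) / 1 + 1 / 1)⁻¹ = Real.sigmoid (W ε - ΔF) := by
  rw [div_one, div_one, Real.sigmoid_def, show -(W ε - ΔF) = ΔF - W ε by ring, add_comm]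

/-- **`1/G − 2` is the left side of `bennett_lower_bound` at `nf = nr = 1`**:
`1/G − 2 = 1/E_{P_R}[(e^{ΔF−W}/1 + 1/1)⁻¹] − 1/1 − 1/1`.  With
`NCMCGeneralSpaceBennettOptimal.bennett_lower_bound`: the ratio `s²/κ²` of THIS file is `≤ V₁(α)` for
every positive square-integrable fixed statistic `α` — the self-consistent root is as efficient, to
leading order, as the oracle Fermi weight. -/
theorem inv_overlap_sub_two_eq_bennett_bound [IsFiniteMeasure ν₀] [IsFiniteMeasure ν₁]
    [IsMarkovKernel κF] [IsMarkovKernel κR] (h0 : ν₀ univ ≠ 0) (h1 : ν₁ univ ≠ 0)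
    (h : CrooksPair ν₀ ν₁ κF κR s e W) {ΔF : ℝ}
    (hΔF : Real.exp (-ΔF) = ((ν₀ univ)⁻¹ * ν₁ univ).toReal) :
    1 / (∫ ε, Real.sigmoid (ΔF - W ε) ∂(fwdPathLaw ν₀ κF)) - 2 =
      1 / (∫ ε, (Real.exp (ΔF - W ε) / 1 + 1 / 1)⁻¹ ∂(fwdPathLaw ν₁ κR)) - 1 / 1 - 1 / 1 := by
  simp_rw [inv_exp_sub_add_one_eq_sigmoid W ΔF]
  rw [h.integral_sigmoid_rev_eq_overlap h0 h1 hΔF]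
  ring

end CrooksPair

end Summit.Ventures.LatticeQCDFlow.Exactness.GeneralNCMC
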